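import Summits.KontsevichZagierPeriods.KontsevichZagierPeriods.Theses.AbelContraction
import Summits.KontsevichZagierPeriods.KontsevichZagierPeriods.Theorems.HermiteRigidityGenusTwoCycleTransferPushforwardDimOne

/-!
# `GenusOneOneMove` (stmt-KontsevichZagierPeriods-12476, route AbelContraction)

The calibration item of route AbelContraction: genus one of the contraction engine is ONE move of
rule (2) of the Kontsevich–Zagier calculus. For rationals `a₀ < b₀ < a₁ < b₁` and
`Q(x) = (x − a₀)(x − b₀)(x − a₁)(x − b₁)`, the real curve `y² = −Q(x)` has the two bounded ovals over
`(a₀, b₀)` and `(a₁, b₁)`, and the representations `r_j = [(a_j, b_j), 1/√(−Q)]` satisfy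
`[r₁] − [r₀] ∈ KZ.changeOfVariablesRel`.

The witness is the rational Möbius involution `φ` of `ℝP¹` swapping `a₀ ↔ b₁` and `b₀ ↔ a₁`
(translation by the real `2`-torsion point `(a₀,0) − (b₁,0)` of the Jacobian, read on the
`x`-line). Writing `u, v, w, z` for `a₀, b₀, a₁, b₁`:

* `φ(x) = (αx + β)/(γx + δ)` with `α = uz − vw`, `β = vw(u+z) − uz(v+w)`, `γ = u+z−v−w`,
  `δ = vw − uz` (so `α + δ = 0`: `φ` is an involution);
* the four FACTORISATIONS `(αx+β) − e(γx+δ) = c_e · (e' − x)` (`num_sub_mul_den`), e.g.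
  `(αx+β) − u(γx+δ) = (u−v)(u−w)(z−x)`, which give `φ((a₁,b₁)) = (a₀,b₀)` and the KEY IDENTITY
  `Q(φ x)·(γx+δ)⁴ = det²·Q(x)`, `det = αδ − βγ = −(v−u)(w−u)(z−v)(z−w) ≠ 0` (`det_eq`);
* hence, with `φ'(x) = det/(γx+δ)²`, the rule-2 integrand identity
  `1/√(−Q(x)) = (1/√(−Q(φ x)))·|φ'(x)|` holds EXACTLY on `(a₁, b₁)` (`key_identity`,
  `one_div_sqrt_eq`), and `[r₁] − [r₀]` is the `KZ.changeOfVariablesRel` instance along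
  `Φ(p) = (φ(p 0))`, `Φ' p = φ'(p 0) • id` (`det Φ' p = φ'(p 0)`), `Φ` being `ℚ`-semialgebraic
  (a quotient of degree-one polynomials over `ℚ`) and injective (`det ≠ 0`).

Worked instance (route card): `(a, b) = ((0, 2), (1, 4))`, i.e. ovals over `(0,1)` and `(2,4)`:
`φ = (8 − 2x)/(x + 2)`, `det² = 144 = ∏_e (e + 2)`.

`GenusOneOneMove_proof` concludes the route declaration
`Summit.KontsevichZagierPeriods.KontsevichZagierPeriods.Theses.AbelContraction.GenusOneOneMove` by
name. No definitions are introduced (the Möbius data are hypotheses `hα … hδ` of the algebraic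
lemmas and `set`s in the proof). Reused from the tree: `det_smul_id_fin_one`, `hasFDerivAt_fin_one`
(HermiteRigidityGenusTwoCycleTransferPushforwardDimOne), `isSemialgebraicFunOn_aeval_div_aeval`,
`IsSemialgebraicMapOn.of_forall` (SemialgebraicMaps).

References: M. Kontsevich, D. Zagier, *Periods* (2001), §1.2 rule (2); J. H. Silverman,
*The Arithmetic of Elliptic Curves* (2009), III.2–III.3 (translation by a `2`-torsion point on
`y² = quartic`, acting on the `x`-line by a Möbius involution); D. F. Lawden, *Elliptic Functions
and Applications* (1989), §3.1 (bilinear reduction of elliptic integrals).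
-/

noncomputable section

open Set
open Literature.NumberTheory.Transcendental
open Summit.KontsevichZagierPeriods.HermiteRigidity.GenusTwoCycleTransfer
  (det_smul_id_fin_one hasFDerivAt_fin_one)

namespace Summit.KontsevichZagierPeriods.AbelContraction.GenusOneOneMove

variable {u v w z α β γ δ : ℝ}

/-! ### The rational Möbius involution swapping `u ↔ z`, `v ↔ w`: algebra -/

/-- The four factorisations `(αx+β) − e(γx+δ) = c_e·(linear)` for the branch values
`e ∈ {u, v, w, z}` of the Möbius involution `φ = (αx+β)/(γx+δ)` swapping `u ↔ z` and `v ↔ w`: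
they say `φ(z) = u`, `φ(w) = v`, `φ(v) = w`, `φ(u) = z` with explicit cofactors. [folklore] -/
theorem num_sub_mul_den (hα : α = u * z - v * w) (hβ : β = v * w * (u + z) - u * z * (v + w))
    (hγ : γ = u + z - v - w) (hδ : δ = v * w - u * z) (x : ℝ) :
    (α * x + β) - u * (γ * x + δ) = (u - v) * (u - w) * (z - x) ∧
    (α * x + β) - v * (γ * x + δ) = (v - u) * (v - z) * (x - w) ∧
    (α * x + β) - w * (γ * x + δ) = (w - u) * (w - z) * (x - v) ∧
    (α * x + β) - z * (γ * x + δ) = (z - v) * (z - w) * (u - x) := by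
  subst hα hβ hγ hδ
  exact ⟨by ring, by ring, by ring, by ring⟩

/-- The determinant of the Möbius involution: `αδ − βγ = −(v−u)(w−u)(z−v)(z−w)` (negative for
`u < v < w < z`: the involution reverses the orientation of `ℝP¹`). [folklore] -/
theorem det_eq (hα : α = u * z - v * w) (hβ : β = v * w * (u + z) - u * z * (v + w))
    (hγ : γ = u + z - v - w) (hδ : δ = v * w - u * z) :
    α * δ - β * γ = -((v - u) * (w - u) * (z - v) * (z - w)) := by
  subst hα hβ hγ hδ
  ring

/-- The denominator `γx + δ = (x−v)(x−w) − (x−u)(x−z)` is positive on the oval `(w, z)`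
(for `u < v < w`). [folklore] -/
theorem den_pos_right (hγ : γ = u + z - v - w) (hδ : δ = v * w - u * z) (huv : u < v) (hvw : v < w)
    {x : ℝ} (hwx : w < x) (hxz : x < z) : 0 < γ * x + δ := by
  subst hγ hδ
  have h1 : 0 < (x - v) * (x - w) := mul_pos (by linarith) (by linarith)
  have h2 : 0 < (x - u) * (z - x) := mul_pos (by linarith) (by linarith)
  have e : (u + z - v - w) * x + (v * w - u * z) = (x - v) * (x - w) + (x - u) * (z - x) := by ring
  rw [e]
  exact add_pos h1 h2

/-- The denominator `γy + δ = (v−y)(w−y) + (y−u)(z−y)` is positive on the oval `(u, v)`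
(for `v < w < z`). [folklore] -/
theorem den_pos_left (hγ : γ = u + z - v - w) (hδ : δ = v * w - u * z) (hvw : v < w) (hwz : w < z)
    {y : ℝ} (huy : u < y) (hyv : y < v) : 0 < γ * y + δ := by
  subst hγ hδ
  have h1 : 0 < (v - y) * (w - y) := mul_pos (by linarith) (by linarith)
  have h2 : 0 < (y - u) * (z - y) := mul_pos (by linarith) (by linarith)
  have e : (u + z - v - w) * y + (v * w - u * z) = (v - y) * (w - y) + (y - u) * (z - y) := by ring
  rw [e]
  exact add_pos h1 h2

/-- The involution maps the oval `(w, z)` into the oval `(u, v)`. [folklore] -/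
theorem mobius_mem_left (hα : α = u * z - v * w) (hβ : β = v * w * (u + z) - u * z * (v + w))
    (hγ : γ = u + z - v - w) (hδ : δ = v * w - u * z) (huv : u < v) (hvw : v < w)
    {x : ℝ} (hwx : w < x) (hxz : x < z) :
    u < (α * x + β) / (γ * x + δ) ∧ (α * x + β) / (γ * x + δ) < v := by
  have hD := den_pos_right hγ hδ huv hvw hwx hxz
  obtain ⟨h1, h2, -, -⟩ := num_sub_mul_den hα hβ hγ hδ x
  constructor
  · rw [lt_div_iff₀ hD]
    have h : 0 < (α * x + β) - u * (γ * x + δ) := by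
      rw [h1]
      exact mul_pos (mul_pos_of_neg_of_neg (by linarith) (by linarith)) (by linarith)
    linarith
  · rw [div_lt_iff₀ hD]
    have h : (α * x + β) - v * (γ * x + δ) < 0 := by
      rw [h2]
      exact mul_neg_of_neg_of_pos (mul_neg_of_pos_of_neg (by linarith) (by linarith)) (by linarith)
    linarith

/-- The involution maps the oval `(u, v)` into the oval `(w, z)`. [folklore] -/
theorem mobius_mem_right (hα : α = u * z - v * w) (hβ : β = v * w * (u + z) - u * z * (v + w))
    (hγ : γ = u + z - v - w) (hδ : δ = v * w - u * z) (hvw : v < w) (hwz : w < z)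
    {y : ℝ} (huy : u < y) (hyv : y < v) :
    w < (α * y + β) / (γ * y + δ) ∧ (α * y + β) / (γ * y + δ) < z := by
  have hD := den_pos_left hγ hδ hvw hwz huy hyv
  obtain ⟨-, -, h3, h4⟩ := num_sub_mul_den hα hβ hγ hδ y
  constructor
  · rw [lt_div_iff₀ hD]
    have h : 0 < (α * y + β) - w * (γ * y + δ) := by
      rw [h3]
      exact mul_pos_of_neg_of_neg (mul_neg_of_pos_of_neg (by linarith) (by linarith)) (by linarith)
    linarith
  · rw [div_lt_iff₀ hD]
    have h : (α * y + β) - z * (γ * y + δ) < 0 := by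
      rw [h4]
      exact mul_neg_of_pos_of_neg (mul_pos (by linarith) (by linarith)) (by linarith)
    linarith

/-- A Möbius map with `α + δ = 0` is an involution wherever both denominators are non-zero.
[folklore] -/
theorem mobius_invol (hαδ : α + δ = 0) {y : ℝ} (hy : γ * y + δ ≠ 0)
    (ht : γ * ((α * y + β) / (γ * y + δ)) + δ ≠ 0) :
    (α * ((α * y + β) / (γ * y + δ)) + β) / (γ * ((α * y + β) / (γ * y + δ)) + δ) = y := by
  rw [div_eq_iff ht]
  obtain ⟨t, ht'⟩ : ∃ t, (α * y + β) / (γ * y + δ) = t := ⟨_, rfl⟩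
  have htD : t * (γ * y + δ) = α * y + β := by rw [← ht']; exact div_mul_cancel₀ _ hy
  rw [ht']
  have hδ : δ = -α := by linarith
  rw [hδ] at htD ⊢
  linear_combination (-1 : ℝ) * htD

/-- A Möbius map with non-zero determinant is injective off its pole. [folklore] -/
theorem mobius_injective (hdet : α * δ - β * γ ≠ 0) {x y : ℝ} (hx : γ * x + δ ≠ 0)
    (hy : γ * y + δ ≠ 0) (h : (α * x + β) / (γ * x + δ) = (α * y + β) / (γ * y + δ)) : x = y := by
  rw [div_eq_div_iff hx hy] at h
  have h2 : (α * δ - β * γ) * (x - y) = 0 := by linear_combination h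
  rcases mul_eq_zero.mp h2 with h3 | h3
  · exact absurd h3 hdet
  · linarith

/-- A Möbius map has derivative `(αδ − βγ)/(γx+δ)²` off its pole. [folklore] -/
theorem hasDerivAt_mobius (α β γ δ x : ℝ) (hx : γ * x + δ ≠ 0) :
    HasDerivAt (fun y => (α * y + β) / (γ * y + δ)) ((α * δ - β * γ) / (γ * x + δ) ^ 2) x := by
  have hN : HasDerivAt (fun y => α * y + β) α x := by
    simpa using ((hasDerivAt_id x).const_mul α).add_const β
  have hD : HasDerivAt (fun y => γ * y + δ) γ x := by
    simpa using ((hasDerivAt_id x).const_mul γ).add_const δ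
  refine (hN.fun_div hD hx).congr_deriv ?_
  ring

/-- **The key identity** of the move: `Q(φ x)·(γx+δ)⁴ = det²·Q(x)` for
`Q(x) = (x−u)(x−v)(x−w)(x−z)`, in the form `−Q(φ x) = −Q(x)·(det/(γx+δ)²)²` consumed by the
Jacobian identity. [folklore] -/
theorem key_identity (hα : α = u * z - v * w) (hβ : β = v * w * (u + z) - u * z * (v + w))
    (hγ : γ = u + z - v - w) (hδ : δ = v * w - u * z) {x : ℝ} (hx : γ * x + δ ≠ 0) :
    -(((α * x + β) / (γ * x + δ) - u) * ((α * x + β) / (γ * x + δ) - v) *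
        (((α * x + β) / (γ * x + δ) - w) * ((α * x + β) / (γ * x + δ) - z))) =
      -((x - u) * (x - v) * ((x - w) * (x - z))) * ((α * δ - β * γ) / (γ * x + δ) ^ 2) ^ 2 := by
  have e : ∀ e : ℝ, (α * x + β) / (γ * x + δ) - e =
      ((α * x + β) - e * (γ * x + δ)) / (γ * x + δ) := fun e => by
    rw [sub_div, mul_div_assoc, div_self hx, mul_one]
  obtain ⟨h1, h2, h3, h4⟩ := num_sub_mul_den hα hβ hγ hδ x
  rw [e u, e v, e w, e z, h1, h2, h3, h4, det_eq hα hβ hγ hδ]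
  field_simp
  ring

/-- The Jacobian bookkeeping: if `P > 0` and `k ≠ 0` then `1/√P = (1/√(P·k²))·|k|`.
[cite: KontsevichZagier2001, §1.2 rule (2)] -/
theorem one_div_sqrt_eq {P k : ℝ} (hP : 0 < P) (hk : k ≠ 0) :
    1 / Real.sqrt P = 1 / Real.sqrt (P * k ^ 2) * |k| := by
  rw [Real.sqrt_mul hP.le, Real.sqrt_sq_eq_abs]
  have h1 : 0 < |k| := abs_pos.mpr hk
  have h2 : 0 < Real.sqrt P := Real.sqrt_pos.mpr hP
  field_simp

/-- `−Q(x) = −(x−u)(x−v)(x−w)(x−z) > 0` on the oval `(w, z)` (for `u < v < w`). [folklore] -/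
theorem neg_prod_pos (huv : u < v) (hvw : v < w) {x : ℝ} (hwx : w < x) (hxz : x < z) :
    0 < -((x - u) * (x - v) * ((x - w) * (x - z))) := by
  have h1 : 0 < (x - u) * (x - v) := mul_pos (by linarith) (by linarith)
  have h2 : 0 < (x - w) * (z - x) := mul_pos (by linarith) (by linarith)
  have e : -((x - u) * (x - v) * ((x - w) * (x - z))) = (x - u) * (x - v) * ((x - w) * (z - x)) := by
    ring
  rw [e]
  exact mul_pos h1 h2

/-! ### The move -/

/-- **Genus one is one move of rule (2).** For rationals `a₀ < b₀ < a₁ < b₁` and representations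
`r₀ = [(a₀,b₀), 1/√(−Q)]`, `r₁ = [(a₁,b₁), 1/√(−Q)]` with `Q = (x−a₀)(x−b₀)(x−a₁)(x−b₁)`
(domains prescribed, integrands prescribed on the domains), `[r₁] − [r₀] ∈ KZ.changeOfVariablesRel`,
witnessed by the rational Möbius involution `Φ(p) = (φ(p 0))`, `Φ' p = φ'(p 0) • id`.
[cite: KontsevichZagier2001, §1.2 rule (2)] -/
theorem of_sub_of_mem_changeOfVariablesRel (a₀ b₀ a₁ b₁ : ℚ) (h₀ : a₀ < b₀) (h₀₁ : b₀ < a₁)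
    (h₁ : a₁ < b₁) (r₀ r₁ : KZ.IntegralRep 1)
    (hd₀ : r₀.domain = {p | (a₀ : ℝ) < p 0 ∧ p 0 < (b₀ : ℝ)})
    (hd₁ : r₁.domain = {p | (a₁ : ℝ) < p 0 ∧ p 0 < (b₁ : ℝ)})
    (hi₀ : EqOn r₀.integrand (fun p => 1 / Real.sqrt
      (-((p 0 - (a₀ : ℝ)) * (p 0 - (b₀ : ℝ)) * ((p 0 - (a₁ : ℝ)) * (p 0 - (b₁ : ℝ)))))) r₀.domain)
    (hi₁ : EqOn r₁.integrand (fun p => 1 / Real.sqrt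
      (-((p 0 - (a₀ : ℝ)) * (p 0 - (b₀ : ℝ)) * ((p 0 - (a₁ : ℝ)) * (p 0 - (b₁ : ℝ)))))) r₁.domain) :
    KZ.of r₁ - KZ.of r₀ ∈ KZ.changeOfVariablesRel := by
  -- the rational Möbius data
  set αq : ℚ := a₀ * b₁ - b₀ * a₁ with hαq
  set βq : ℚ := b₀ * a₁ * (a₀ + b₁) - a₀ * b₁ * (b₀ + a₁) with hβq
  set γq : ℚ := a₀ + b₁ - b₀ - a₁ with hγq
  set δq : ℚ := b₀ * a₁ - a₀ * b₁ with hδq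
  -- real names
  have huv : (a₀ : ℝ) < b₀ := by exact_mod_cast h₀
  have hvw : (b₀ : ℝ) < a₁ := by exact_mod_cast h₀₁
  have hwz : (a₁ : ℝ) < b₁ := by exact_mod_cast h₁
  have hαc : ((αq : ℚ) : ℝ) = (a₀ : ℝ) * b₁ - b₀ * a₁ := by rw [hαq]; push_cast; ring
  have hβc : ((βq : ℚ) : ℝ) = (b₀ : ℝ) * a₁ * (a₀ + b₁) - a₀ * b₁ * (b₀ + a₁) := by
    rw [hβq]; push_cast; ring
  have hγc : ((γq : ℚ) : ℝ) = (a₀ : ℝ) + b₁ - b₀ - a₁ := by rw [hγq]; push_cast; ring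
  have hδc : ((δq : ℚ) : ℝ) = (b₀ : ℝ) * a₁ - a₀ * b₁ := by rw [hδq]; push_cast; ring
  set u : ℝ := (a₀ : ℝ) with hu
  set v : ℝ := (b₀ : ℝ) with hv
  set w : ℝ := (a₁ : ℝ) with hw
  set z : ℝ := (b₁ : ℝ) with hz
  set α : ℝ := ((αq : ℚ) : ℝ) with hα'
  set β : ℝ := ((βq : ℚ) : ℝ) with hβ'
  set γ : ℝ := ((γq : ℚ) : ℝ) with hγ'
  set δ : ℝ := ((δq : ℚ) : ℝ) with hδ'
  have hα : α = u * z - v * w := hαc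
  have hβ : β = v * w * (u + z) - u * z * (v + w) := hβc
  have hγ : γ = u + z - v - w := hγc
  have hδ : δ = v * w - u * z := hδc
  have hdet : α * δ - β * γ ≠ 0 := by
    rw [det_eq hα hβ hγ hδ]
    have h : 0 < (v - u) * (w - u) * (z - v) * (z - w) :=
      mul_pos (mul_pos (mul_pos (by linarith) (by linarith)) (by linarith)) (by linarith)
    linarith
  -- the denominator is positive on the source oval `(w, z)`
  have hD₁ : ∀ p ∈ r₁.domain, 0 < γ * p 0 + δ := fun p hp => by
    rw [hd₁] at hp
    exact den_pos_right hγ hδ huv hvw hp.1 hp.2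
  -- the map and its derivative
  set Φ : (Fin 1 → ℝ) → (Fin 1 → ℝ) := fun p _ => (α * p 0 + β) / (γ * p 0 + δ) with hΦ_def
  set Φ' : (Fin 1 → ℝ) → ((Fin 1 → ℝ) →L[ℝ] (Fin 1 → ℝ)) :=
    fun p => ((α * δ - β * γ) / (γ * p 0 + δ) ^ 2) • ContinuousLinearMap.id ℝ (Fin 1 → ℝ)
    with hΦ'_def
  have hdet' : ∀ p, (Φ' p).det = (α * δ - β * γ) / (γ * p 0 + δ) ^ 2 := fun p =>
    det_smul_id_fin_one _
  -- the image of the source oval is the target oval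
  have himg : r₀.domain = Φ '' r₁.domain := by
    rw [hd₀, hd₁]
    ext q
    simp only [mem_image, mem_setOf_eq]
    constructor
    · rintro ⟨hq1, hq2⟩
      have hy := mobius_mem_right hα hβ hγ hδ hvw hwz hq1 hq2
      refine ⟨fun _ => (α * q 0 + β) / (γ * q 0 + δ), hy, ?_⟩
      funext i
      rw [Fin.fin_one_eq_zero i]
      exact mobius_invol (by rw [hα, hδ]; ring) (den_pos_left hγ hδ hvw hwz hq1 hq2).ne'
        (den_pos_right hγ hδ huv hvw hy.1 hy.2).ne'
    · rintro ⟨p, ⟨hp1, hp2⟩, rfl⟩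
      exact mobius_mem_left hα hβ hγ hδ huv hvw hp1 hp2
  refine ⟨1, r₁, r₀, Φ, Φ', ?_, ?_, ?_, himg, ?_, rfl⟩
  · -- `Φ` is a `ℚ`-semialgebraic map: a quotient of degree-one polynomials over `ℚ`
    refine IsSemialgebraicMapOn.of_forall r₁.isSemialgebraic_domain fun _ => ?_
    have h := isSemialgebraicFunOn_aeval_div_aeval r₁.isSemialgebraic_domain
      (MvPolynomial.C αq * MvPolynomial.X 0 + MvPolynomial.C βq : MvPolynomial (Fin 1) ℚ)
      (MvPolynomial.C γq * MvPolynomial.X 0 + MvPolynomial.C δq : MvPolynomial (Fin 1) ℚ)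
      (fun p hp => by
        simp only [map_add, map_mul, MvPolynomial.aeval_C, MvPolynomial.aeval_X, eq_ratCast]
        exact (hD₁ p hp).ne')
    refine h.congr fun p _ => ?_
    simp only [map_add, map_mul, MvPolynomial.aeval_C, MvPolynomial.aeval_X, eq_ratCast]
    rfl
  · -- derivative within the oval
    intro p hp
    exact (hasFDerivAt_fin_one (fun y => (α * y + β) / (γ * y + δ)) _ p
      (hasDerivAt_mobius α β γ δ (p 0) (hD₁ p hp).ne')).hasFDerivWithinAt
  · -- injectivity (`det ≠ 0`)
    intro p hp q hq h
    have h' : (α * p 0 + β) / (γ * p 0 + δ) = (α * q 0 + β) / (γ * q 0 + δ) := congrFun h 0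
    have hpq : p 0 = q 0 := mobius_injective hdet (hD₁ p hp).ne' (hD₁ q hq).ne' h'
    funext i
    rw [Fin.fin_one_eq_zero i]
    exact hpq
  · -- the Jacobian identity, exactly on the oval
    intro p hp
    have hmem : Φ p ∈ r₀.domain := himg ▸ mem_image_of_mem Φ hp
    have hp' : w < p 0 ∧ p 0 < z := by rw [hd₁] at hp; exact hp
    rw [hi₁ hp, hi₀ hmem, hdet' p]
    show 1 / Real.sqrt (-((p 0 - u) * (p 0 - v) * ((p 0 - w) * (p 0 - z)))) =
      1 / Real.sqrt (-(((α * p 0 + β) / (γ * p 0 + δ) - u) * ((α * p 0 + β) / (γ * p 0 + δ) - v) *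
        (((α * p 0 + β) / (γ * p 0 + δ) - w) * ((α * p 0 + β) / (γ * p 0 + δ) - z)))) *
        |(α * δ - β * γ) / (γ * p 0 + δ) ^ 2|
    rw [key_identity hα hβ hγ hδ (hD₁ p hp).ne']
    exact one_div_sqrt_eq (neg_prod_pos huv hvw hp'.1 hp'.2)
      (div_ne_zero hdet (pow_ne_zero 2 (hD₁ p hp).ne'))

/-- **`GenusOneOneMove`** (stmt-KontsevichZagierPeriods-12476): for rationals `a₀ < b₀ < a₁ < b₁`
and `Q = ∏ᵢ (x − aᵢ)(x − bᵢ)`, the representations `r_j = [(a_j, b_j), 1/√(−Q)]` satisfy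
`[r₁] − [r₀] ∈ KZ.changeOfVariablesRel` — one move of rule (2) along the rational Möbius
involution swapping `a₀ ↔ b₁`, `b₀ ↔ a₁` (`of_sub_of_mem_changeOfVariablesRel`).
[cite: KontsevichZagier2001, §1.2 rule (2)] -/
theorem GenusOneOneMove_proof :
    Summit.KontsevichZagierPeriods.KontsevichZagierPeriods.Theses.AbelContraction.GenusOneOneMove := by
  unfold Summit.KontsevichZagierPeriods.KontsevichZagierPeriods.Theses.AbelContraction.GenusOneOneMove
  intro a b hab hba r hdom hint
  have hi₀ := hint 0
  have hi₁ := hint 1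
  simp only [Fin.prod_univ_two] at hi₀ hi₁
  exact of_sub_of_mem_changeOfVariablesRel (a 0) (b 0) (a 1) (b 1) (hab 0) hba (hab 1) (r 0) (r 1)
    (hdom 0) (hdom 1) hi₀ hi₁

end Summit.KontsevichZagierPeriods.AbelContraction.GenusOneOneMove

end
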